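import Summits.ResolutionOfSingularities.ResolutionOfSingularities.Theorems.MarkedTransferCampaignW46HonestStep
import Literature.AlgebraicGeometry.Hironaka2017.Proofs.S16Proof.ExceptionalIrreducible
import Literature.AlgebraicGeometry.Hironaka2017.Lib.LSBLift
import Literature.AlgebraicGeometry.Resolution.BlowupOffCentre
import Literature.AlgebraicGeometry.Resolution.ExceptionalDivisorRegularGlobal
import HarnessLib

/-!
# [OURS · L1 W4.6 rung (i-f)] HONEST STEPS PRESERVE «SINGULAR CURVES REGULAR» on surfaces (cell res-hironaka,
# LADDER-RESOLUTION rung L, D-0089; campaign s46, prover res-L1-s46-pv-1; host route MarkedTransfer,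
# `--supports stmt-ResolutionOfSingularities-16155`)

HONEST FRAMING. Nothing here is a statement of H. Hironaka's manuscript (2017-03-23, [Hironaka2017]) and nothing here
asserts that any statement of it holds. Everything is OURS or tree geometry (blow-ups: exceptional divisor regular and
reduced, Liu 8.1.19; reduced structures off the centre, BGMW 8.0.5). AI-written; weaker than expert review. No `sorry`;
axioms standard.

## What and why

`Regime.singCurvesRegular A E` — the closure of every non-closed point of `Sing(E)` (on a surface: every curve of the
singular locus) has regular reduced structure — is the class in which the honest (non-procrastinating) step always exists
(`exists_honestStep`, companion `…HonestStep`). This file proves the class is STABLE under every non-procrastinating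
§2.1-permissible step between states of dimension `≤ 2` (`singCurvesRegular_transform`): a singular curve of the transform
is either the exceptional curve of a point step (regular: Liu 8.1.19 (b), tree `IsBlowup.isRegular_subscheme_comap` +
`comap_vanishingIdeal_eq_vanishingIdeal_preimage'`), or the preimage of a singular curve missing the (isolated) centre
(tree `IsBlowup.isRegular_subscheme_vanishingIdeal_preimage`), or — at a divisorial step, an isomorphism — the preimage
of a singular curve (smooth pull-back). With rung (i-b) this yields the existence of resolutions by the honest procedure
(companion `…HonestResolution`).

## References

* Q. Liu, Algebraic Geometry and Arithmetic Curves (2002), Thm. 8.1.19. [Liu2002]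
* H. Hironaka, ms. 2017-03-23, §2.1 p.4 l.34–39 — scope only, under adjudication, not cited as fact. [Hironaka2017]
-/

noncomputable section

set_option linter.dupNamespace false -- mandated namespace of this single-conjunct summit

open CategoryTheory AlgebraicGeometry TopologicalSpace

namespace Summit.ResolutionOfSingularities.ResolutionOfSingularities.Theorems

namespace CampaignW46

open Literature.AlgebraicGeometry.Resolution
open Literature.AlgebraicGeometry.Hironaka2017.S02Preliminaries
open Literature.AlgebraicGeometry.Hironaka2017.Datum
open Scheme.IdealSheafData

universe u

variable {p : ℕ} [Fact p.Prime] {K : Type u} [Field K] [CharP K p]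

/-! ## The class -/

/-- [OURS · L1 W4.6 rung (i-f)] NOT a statement of the manuscript. **The regime «singular curves are regular»**: the
closure of every non-closed point of `Sing(E)` has regular reduced structure (on a surface: every curve of the singular
locus is a regular curve; isolated singular points impose nothing). [folklore] -/
def Regime.singCurvesRegular : Regime p K := fun A E =>
  ∀ η ∈ E.sing, ¬ IsClosed ({η} : Set A.Z) →
    Scheme.IsRegular (vanishingIdeal (⟨closure {η}, isClosed_closure⟩ : Closeds A.Z)).subscheme

/-! ## Topological lemmas -/

/-- On a scheme of dimension `≤ 2`, a non-closed point of a proper irreducible closed subset is its generic point: its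
closure is the whole subset. [folklore] -/
theorem closure_singleton_eq_of_dim_le_two {Z : Scheme.{u}} [IsIntegral Z] (hdim : topologicalKrullDim Z ≤ 2)
    {S : Set Z} (hS : IsIrreducible S) (hScl : IsClosed S) (hSne : S ≠ Set.univ) {η : Z} (hη : η ∈ S)
    (hncl : ¬ IsClosed ({η} : Set Z)) : closure {η} = S := by
  obtain ⟨γ, hγ⟩ : ∃ γ : Z, IsGenericPoint γ S := ⟨_, hS.isGenericPoint_genericPoint hScl⟩
  by_contra hne
  -- `η ≠ γ` and `γ ⤳ η`
  have hηγ : η ≠ γ := fun h => hne (by rw [h]; exact hγ.def)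
  have hsp : γ ⤳ η := hγ.specializes hη
  have hlt₁ : η < γ := lt_of_le_not_ge (Scheme.le_iff_specializes.mpr hsp) fun h' =>
    hηγ (Specializes.antisymm (Scheme.le_iff_specializes.mp h') hsp).eq
  -- a strict specialisation of `η`
  obtain ⟨x, hxcl, hxne⟩ : ∃ x, x ∈ closure ({η} : Set Z) ∧ x ∉ ({η} : Set Z) := by
    have hss : ({η} : Set Z) ⊂ closure {η} :=
      subset_closure.ssubset_of_ne fun h => hncl (by rw [h]; exact isClosed_closure)
    exact Set.exists_of_ssubset hss
  rw [Set.mem_singleton_iff] at hxne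
  have hsp₂ : η ⤳ x := specializes_iff_mem_closure.mpr hxcl
  have hlt₂ : x < η := lt_of_le_not_ge (Scheme.le_iff_specializes.mpr hsp₂) fun h' =>
    hxne (Specializes.antisymm (Scheme.le_iff_specializes.mp h') hsp₂).eq
  -- heights: `height γ ≥ 2`
  have hh : (1 : ℕ∞) + 1 ≤ Order.height γ := by
    have h1 : Order.height x + 1 ≤ Order.height η := Order.height_add_one_le hlt₂
    have h2 : Order.height η + 1 ≤ Order.height γ := Order.height_add_one_le hlt₁
    have h1' : (1 : ℕ∞) ≤ Order.height η := le_trans (self_le_add_left 1 (Order.height x)) h1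
    have h1'' : (1 : ℕ∞) + 1 ≤ Order.height η + 1 := by gcongr
    exact h1''.trans h2
  -- coheight: `γ` is not the generic point of `Z`
  have hc : (1 : ℕ∞) ≤ Order.coheight γ := by
    rw [Order.one_le_iff_ne_zero]
    intro h0
    apply hSne
    rw [← hγ.def, eq_genericPoint_of_coheight_eq_zero h0]
    exact (genericPoint_spec Z).def
  have h3 : ((Order.height γ + Order.coheight γ : ℕ∞) : WithBot ℕ∞) ≤ 2 :=
    (coe_height_add_coheight_le_topologicalKrullDim γ).trans hdim
  have h4 : Order.height γ + Order.coheight γ ≤ 2 := WithBot.coe_le_coe.mp h3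
  have h5 : (1 : ℕ∞) + 1 + 1 ≤ Order.height γ + Order.coheight γ := add_le_add hh hc
  have h6 : (1 : ℕ∞) + 1 + 1 ≤ 2 := h5.trans h4
  norm_num at h6

/-- If `π` is injective over `y` (the fibre is `{η′}`) and `{y}` is closed then `{η′}` is closed. [folklore] -/
theorem isClosed_singleton_of_fibre {Z Z' : Scheme.{u}} (π : Z' ⟶ Z) {η' : Z'}
    (hfib : ∀ z : Z', π z = π η' → z = η') (hcl : IsClosed ({π η'} : Set Z)) : IsClosed ({η'} : Set Z') := by
  have h : ({η'} : Set Z') = π ⁻¹' {π η'} := by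
    ext z
    simp only [Set.mem_singleton_iff, Set.mem_preimage]
    exact ⟨fun h => by rw [h], hfib z⟩
  rw [h]
  exact hcl.preimage π.continuous

/-! ## Persistence -/

section Persistence

/-- The reduced structure of a §2.1-permissible centre is regular (smooth over a field). [folklore] -/
theorem isRegular_subscheme_of_isPermissibleCentre (A : AmbientDatum p K) {E : IdealExponent A.Z} {D : Closeds A.Z}
    (hD : E.IsPermissibleCentre A.hom D) : Scheme.IsRegular (vanishingIdeal D).subscheme := by
  haveI := hD.smooth
  exact fun z => isRegularLocalRing_stalk_of_smooth_of_field ((vanishingIdeal D).subschemeι ≫ A.hom) z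

/-- Singular points of the transform lie over singular points (permissible centre: `D ⊆ Sing(E)`; off `D` the singular
locus is unchanged). [folklore] -/
theorem mem_sing_of_mem_sing_transform {A A' : AmbientDatum p K} (E : IdealExponent A.Z) {D : Closeds A.Z}
    (hD : E.IsPermissibleCentre A.hom D) {π : A'.Z ⟶ A.Z} (hπ : IsBlowup π (vanishingIdeal D)) {η' : A'.Z}
    (hη' : η' ∈ (E.transform π D).sing) : π η' ∈ E.sing := by
  haveI : IsLocallyNoetherian A'.Z := ambient_isLocallyNoetherian A'
  by_cases hmem : π η' ∈ (D : Set A.Z)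
  · exact hD.subset_sing hmem
  · exact (mem_sing_transform_iff_of_not_mem hπ E hmem).mp hη'

/-- **PERSISTENCE.** [OURS · L1 W4.6 rung (i-f)] NOT a statement of the manuscript. A non-procrastinating §2.1-permissible
step between states of dimension `≤ 2` (standard `E`) carries the regime «singular curves are regular» to the transform.
[cite: Liu2002, Thm. 8.1.19] -/
theorem singCurvesRegular_transform (A A' : AmbientDatum p K) (E : IdealExponent A.Z) (hE : E.IsStandard)
    (hdimZ : topologicalKrullDim A.Z ≤ 2) (hP : Regime.singCurvesRegular A E) {D : Closeds A.Z}
    (hD : E.IsPermissibleCentre A.hom D) (hnp : ¬ CentreProcrastinates E D) {π : A'.Z ⟶ A.Z}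
    (hπ : IsBlowup π (vanishingIdeal D)) : Regime.singCurvesRegular A' (E.transform π D) := by
  haveI := ambient_isIntegral A
  haveI := ambient_isIntegral A'
  haveI : IsLocallyNoetherian A.Z := ambient_isLocallyNoetherian A
  haveI : IsLocallyNoetherian A'.Z := ambient_isLocallyNoetherian A'
  have hZreg : Scheme.IsRegular A.Z := ambient_isRegular A
  have hDreg := isRegular_subscheme_of_isPermissibleCentre A hD
  have hdimZ' : topologicalKrullDim A'.Z ≤ 2 := hπ.topologicalKrullDim_le hdimZ
  have hDne : (D : Set A.Z) ≠ Set.univ := ne_univ_of_subset_sing A hE hD.subset_sing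
  -- `π` is surjective (proper birational)
  have hIne : vanishingIdeal D ≠ ⊥ := by
    intro h
    apply hDne
    rw [← Scheme.IdealSheafData.coe_support_vanishingIdeal D, h, Scheme.IdealSheafData.support_bot]
    rfl
  haveI : IsProper π := hπ.isProper
  have hsurj : Function.Surjective π := (hπ.isBirational' hIne).surjective_of_universallyClosed
  intro η' hη'S hη'cl
  set y := π η' with hy
  have hyS : y ∈ E.sing := mem_sing_of_mem_sing_transform E hD hπ hη'S
  -- the generic point of the centre
  obtain ⟨ζ, hζ⟩ : ∃ ζ : A.Z, IsGenericPoint ζ (D : Set A.Z) :=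
    ⟨_, hD.irreducible.isGenericPoint_genericPoint D.isClosed⟩
  by_cases hdiv : Order.coheight ζ = 1
  · -- divisorial step: `π` is an isomorphism; pull the regular curve `cl{y}` back
    haveI : IsIso π := isIso_of_curveCentre A A' hζ hdiv hπ
    have hinj : Function.Injective π := π.isOpenEmbedding.injective
    have hycl : ¬ IsClosed ({y} : Set A.Z) := fun h =>
      hη'cl (isClosed_singleton_of_fibre π (fun z hz => hinj hz) h)
    have hC := hP y hyS hycl
    set C : Closeds A.Z := ⟨closure {y}, isClosed_closure⟩ with hCdef
    have hpre : closure ({η'} : Set A'.Z) = π ⁻¹' (C : Set A.Z) := by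
      change closure ({η'} : Set A'.Z) = π ⁻¹' closure {π η'}
      rw [π.isOpenEmbedding.isOpenMap.preimage_closure_eq_closure_preimage π.continuous]
      congr 1
      ext z
      simp only [Set.mem_preimage, Set.mem_singleton_iff]
      exact ⟨fun h => by rw [h], fun h => hinj h⟩
    have hreg' : Scheme.IsRegular (vanishingIdeal (C.preimage π.continuous)).subscheme := by
      rw [vanishingIdeal_preimage_eq_comap_of_smooth π C hC]
      exact isRegular_subscheme_comap_of_smooth π (vanishingIdeal C) hC
    have hEq : (⟨closure {η'}, isClosed_closure⟩ : Closeds A'.Z) = C.preimage π.continuous := Closeds.ext hpre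
    rw [hEq]
    exact hreg'
  · -- point step: the centre is the closed point `ζ`, isolated in `Sing(E)`
    have hζcl : IsClosed ({ζ} : Set A.Z) := by
      by_contra hncl
      exact hdiv (coheight_eq_one_of_not_isClosed A hE hdimZ hD hζ hncl)
    have hDeq : (D : Set A.Z) = {ζ} := hζ.def.symm.trans hζcl.closure_eq
    have hnp' : ∀ w ∈ E.sing, w ⤳ ζ → w = ζ := by
      intro w hwS hsp
      by_contra hne
      exact hnp ⟨ζ, w, hDeq, hwS, hne, hsp⟩
    by_cases hyζ : y ∈ (D : Set A.Z)
    · -- over the centre: `cl{η'}` is the exceptional curve, regular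
      have hyζ' : y = ζ := by rw [hDeq] at hyζ; exact hyζ
      set e : Closeds A'.Z := D.preimage π.continuous with hedef
      have hereg : Scheme.IsRegular (vanishingIdeal e).subscheme := by
        rw [hedef, ← hπ.comap_vanishingIdeal_eq_vanishingIdeal_preimage' hZreg hDreg]
        exact hπ.isRegular_subscheme_comap hZreg hDreg
      have heirr : IsIrreducible (e : Set A'.Z) := by
        have h := Literature.AlgebraicGeometry.Hironaka2017.S16Proof.isIrreducible_exceptional A E D π hE ⟨hπ, hD⟩
        rw [support_comap, Closeds.coe_preimage, Scheme.IdealSheafData.coe_support_vanishingIdeal] at h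
        rw [hedef, Closeds.coe_preimage]
        exact h
      have hene : (e : Set A'.Z) ≠ Set.univ := by
        intro h
        apply hDne
        refine Set.eq_univ_of_forall fun z => ?_
        obtain ⟨z', rfl⟩ := hsurj z
        have : z' ∈ (e : Set A'.Z) := h ▸ Set.mem_univ z'
        exact this
      have hηe : η' ∈ (e : Set A'.Z) := by
        change π η' ∈ (D : Set A.Z)
        exact hyζ
      have hcl : closure ({η'} : Set A'.Z) = (e : Set A'.Z) :=
        closure_singleton_eq_of_dim_le_two hdimZ' heirr e.isClosed hene hηe hη'cl
      have hEq : (⟨closure {η'}, isClosed_closure⟩ : Closeds A'.Z) = e := Closeds.ext hcl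
      rw [hEq]
      exact hereg
    · -- off the centre: the preimage of the regular curve `cl{y}`, which misses `ζ`
      have hoff : ∀ z : A'.Z, π z = y → π z ∉ ((vanishingIdeal D).support : Set A.Z) := by
        intro z hz
        rw [Scheme.IdealSheafData.coe_support_vanishingIdeal, hz]
        exact hyζ
      have hfib : ∀ z : A'.Z, π z = π η' → z = η' := fun z hz =>
        blowup_injOn_off_centre hπ (hoff z hz) (hoff η' rfl) hz
      have hycl : ¬ IsClosed ({y} : Set A.Z) := fun h => hη'cl (isClosed_singleton_of_fibre π hfib h)
      have hC := hP y hyS hycl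
      set C : Closeds A.Z := ⟨closure {y}, isClosed_closure⟩ with hCdef
      have hCsub : (C : Set A.Z) ⊆ E.sing :=
        (A.isClosed_sing E).closure_subset_iff.mpr (Set.singleton_subset_iff.mpr hyS)
      have hdisj : Disjoint (C : Set A.Z) ((vanishingIdeal D).support : Set A.Z) := by
        rw [Scheme.IdealSheafData.coe_support_vanishingIdeal, hDeq, Set.disjoint_singleton_right]
        intro hζC
        have hsp : y ⤳ ζ := specializes_iff_mem_closure.mpr hζC
        have hyne : y ≠ ζ := fun h => hyζ (by rw [hDeq, h]; rfl)
        exact hyne (hnp' y hyS hsp)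
      have hreg' : Scheme.IsRegular (vanishingIdeal (C.preimage π.continuous)).subscheme :=
        hπ.isRegular_subscheme_vanishingIdeal_preimage C hdisj hC
      have hirr : IsIrreducible (π ⁻¹' (C : Set A.Z)) :=
        hπ.isIrreducible_preimage_of_disjoint C hdisj isIrreducible_singleton.closure
      have hne : (π ⁻¹' (C : Set A.Z)) ≠ Set.univ := by
        intro h
        apply ne_univ_of_subset_sing A hE hCsub
        refine Set.eq_univ_of_forall fun z => ?_
        obtain ⟨z', rfl⟩ := hsurj z
        have : z' ∈ π ⁻¹' (C : Set A.Z) := h ▸ Set.mem_univ z'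
        exact this
      have hηC : η' ∈ π ⁻¹' (C : Set A.Z) := by
        change π η' ∈ closure {y}
        exact subset_closure rfl
      have hcl : closure ({η'} : Set A'.Z) = π ⁻¹' (C : Set A.Z) :=
        closure_singleton_eq_of_dim_le_two hdimZ' hirr ((C.isClosed).preimage π.continuous) hne hηC hη'cl
      have hEq : (⟨closure {η'}, isClosed_closure⟩ : Closeds A'.Z) = C.preimage π.continuous := Closeds.ext hcl
      rw [hEq]
      exact hreg'

end Persistence

end CampaignW46

end Summit.ResolutionOfSingularities.ResolutionOfSingularities.Theorems

end
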